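import Summits.QuantumFields.YangMills.Theorems.UnitScaleTiltHalvingStepOfPillarsPrime
import HarnessLib

/-!
# Route `UnitScaleTilt`, crux K1 child «MinimiserStabilityRegPr» (stmt-QuantumFields-19200), registered stub V2′ `stub_halvingStep` (v8∕v10 `BirthV10`) —
# **THE DOOR WITH THE ROOM BINDER, FILE 1∕2 (★★OWNER RULINGS №27 (R-a) «hP1-HOLONOMY», №29 (A); LEAD-H L-4 + addendum): THE ROOM HALVING IN MINIMISER CURRENCY FROM
# THREE DISPLAYED TEXTS** — the P2 text `FlatOpsAdmAtMS` (hP2; inhabited by ✓p625735 `flatOpsAdmAtMS_allL`), the P1♭ v1.1 text AT THE MEMBERS WITH ROOM (hP1room: supplier's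
# floors `(Mₚ, Rₚ)` on the big blocks∕separation, room letter `Nr` next to `B₁`, premise `2 * ρ + Nr ≤ F.L ^ (F.m + n)` right after `hnK`, conclusion ✓`P1FlatPillarAt'` on `□₀`),
# and the C_E-end rows (hCE: ✓p626483's `hCE′` with a floor letter `Nce` and premise `Nce ≤ F.L ^ (F.m + n)` right after `hnK`, otherwise byte-identical)

Cell `ym3-torus` (HUMAN RULING D-0037, YM ladder rung R3 — continuum SU(2) YM₃ on the torus is a RUNG, not the Clay problem), width seat `ym-ust-19200-w3` gen 5.
`--supports stmt-QuantumFields-19200 --as helper`; def-free, 0 sorry, standard axioms.  The three texts are HYPOTHESES; nothing here claims the stub, the crux, the rung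
or the mass gap.

WHY (★★OWNER RULING №27, ★w1-20520 g6's located witness `HAZARD-hP1-HOLONOMY-w1g6.md`).  The doors ✓`halvingStep_of_rows` (p623036) ∕ ✓`halvingStep_of_rows'` (p626483)
display `hP1 : … ∃ B₁, ∀ ρ a Cr, … → P1FlatPillar(') L ρ S M …` with `ρ` universal AFTER `B₁` and the pillar quantifying over EVERY member `F` (`F.L = L`), all `n < K`:
at a member whose top cube of radius `ρ` wraps the level-`(K−n)` torus (`2·L^{F.m+n}` sites per direction) the chart identity (ii)∕(ii′) sits on every fine bond and forces
`‖Hol_γ(U) − 1‖ ≤ 2L^{m+n}B₁ε₀ < 2` along a straight fine cycle, while flat constant abelian data in the regular fibre have central holonomy `−1`.  So `hP1` as typed is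
uninhabitable (the doors stay true, vacuously).  The repair of record (L-4): ONE room premise `2ρ + Nr ≤ L^{F.m+n}` inside the member quantifier of the P1-type text, the
letter `Nr` being the SUPPLIER's (∃-bound next to `B₁`; every geometric no-wrap the J-N05♭ route needs follows by taking `Nr` large); the C_E supplier's floor
`a′ + 3 ≤ m + n` is absorbed the same way (`Nce := L^{a′+3}`); the members below the resulting floor `N := max (2ρ + Nr) Nce` are NOT claimed («H-SMALL», ★★OWNER №29 (B)).

HOW.  Per odd `L > 1` the constants are chosen exactly as in ✓`halvingStep_of_rows'` (P2 → C_E floors (M₁,R₁), P1♭ floors (Mₚ,Rₚ) → `M = L^{aₑ}`, `R = max (max R₁ R₀) (max 1 Rₚ)`, `S = R·M` → `(B₁, Nr)` →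
`(Nce, K₁, K₂, C₂, Cce, aCE)` → `C′ := max (max 12 C₂) ((Cce+2)∕(B₀B₃))` → `ρ` by ✓`HalvingAssembly.exists_rho_163` → `Cr := 4C′B₀B₃`, ceiling `a`), then
`a₅ := Prop8LastMile.exists_a5 (K₁+K₂+1) a`, `B₃ := Cr`, `N := max (2ρ + Nr) Nce`.  Per member with `N ≤ L^{F.m+n}` and per minimiser: §1 reduces the halving to the
(167)-charts around every site in the regime `Crε₁ < ε₀`; there `hP1room → (u, A)` (seven `P1FlatPillarAt'` conjuncts; (ii′) on `□₀` gives the package's layer chart by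
✓`sideTouches_subset_cube0`, `S ≥ 1`) `→ hCE → ✓sitePackage_of_rows →` P2 at `cubeSeqMT3 F n K x ρ S M` (✓`adm22_cubeSeqMT3`, canonical level weights, `H = flatH` by
✓`isFlatH_flatH`) `→ ✓HalvingAssemblyInterior.siteClause_of_pieces_int` (= the body of ✓`H_of_packageInt`, member-local).  Even `L` is vacuous (every `T3Family` has odd `L`).

WHAT THIS FILE PROVES (no definition, no sorry):
* §1 `regPrHalving_of_memberCharts` — the last mile AT ONE MEMBER: (167)-charts around every site of ONE configuration `U ∈ 𝔘_k(ε₀)` (asked only in the regime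
  `B₃ε₁ < ε₀`, (1.140)-radius `¼max{B₃ε₁, ½ε₀} + Kε₀²`) ⟹ `RegPr F n K (max (B₃ε₁) (ε₀∕2)) U` for `ε₀ ≤ a₅ ≤ 1∕90`, `24Ka₅ < 1`
  (✓`Prop8LastMile.halvingMinimisers_of_localCharts167`'s body, member-local).
* §2 ★★ **`roomHalving_of_rows (hP2) (hP1room) (hCE)`** : `∀ L > 1, ∃ (N : ℕ) (B₃ a₅ : ℝ), 4 < B₃ ∧ 0 < a₅ ∧ ∀ F, F.L = L → ∀ n K (hnK : n < K), N ≤ F.L ^ (F.m + n) →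
  ∀ ε₀ ε₁, 0 < ε₁ → 0 < ε₀ → ε₀ ≤ a₅ → ∀ V, PlaqSmall ε₁ V → ∀ U ∈ regFibrePr F n K _ ε₀ V, IsMinOn wilsonAction4 (regFibrePr …) U → RegPr F n K (max (B₃ε₁) (ε₀∕2)) U`
  — ✓`Prop8Iter.halvingLiteral_of_minimisers`' hypothesis shape with the ONE extra premise `N ≤ L^{F.m+n}`.  FILE 2 (`…HalvingStepOfPillarsRoomDoor`) turns it into the
  room-stub text `RoomHalvingText L` of LEAD-H L-4 addendum (A) (`halvingStep_of_rows_room`).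
HONEST SCOPE.  Assembly and constants bookkeeping only.  H debt after these two files, BY NAME: hP2 ✓ (p625735); hP1room ⇐ J-N05♭ `core′` (D1) + J5 under the room
premise; hCE ⇐ `ceRows_of_chart` (★w8-19200 lineage L4, now with the floor letter `Nce` at its disposal); H-SMALL ⇐ `stub_of_roomHalving` (OPEN, ★★OWNER №29 (B)).
NOT a claim about the stub, the crux, the rung or the mass gap.

References: T. Bałaban, CMP **102** (1985) 277–309 [Balaban1985Variational] (144) p.300, (152)–(168) pp.301–304, Prop. 8 p.304; CMP **99** (1985) 75–102
[Balaban1985RegularSpaces] Thm 2 p.83, (1.140) p.100.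
-/

set_option autoImplicit false

noncomputable section

open scoped BigOperators Matrix.Norms.L2Operator

namespace Summit.QuantumFields.YangMills.Theorems.HalvingStepOfPillarsRoom

open Literature.MathematicalPhysics.QuantumFieldTheory.Balaban1983to89
open Literature.MathematicalPhysics.QuantumFieldTheory.Balaban1983to89.T3ContinuumYM3Torus
open Literature.MathematicalPhysics.QuantumFieldTheory.Balaban1983to89.T3PrintedRegularMinimiser
open Literature.MathematicalPhysics.QuantumFieldTheory.Balaban1983to89.T3PrintedMinimiserExistence
open Literature.MathematicalPhysics.QuantumFieldTheory.Balaban1983to89.T3Thm1Carrier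
open Literature.MathematicalPhysics.QuantumFieldTheory.Balaban1983to89.T3Thm1CarrierNative (IsCritR2)
open Literature.MathematicalPhysics.QuantumFieldTheory.Balaban1983to89.T3UnitLawDensityEML (ℰp)
open Literature.MathematicalPhysics.QuantumFieldTheory.Balaban1983to89.T3ConstrainedMinimiser (fibre)
open Complex (I)
open B5Eq117TorusCarriers (Mk)
open B5Eq118OneStroke (iterBlockOf)
open B5Prop12FieldsLattice (distSite distSite_self)
open B6SectADomainsV1 (Domains)
open B6SectAOperatorsV1 (BondIdx SiteIdx)
open B7Prop1Explicit (expUnit)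
open B7Eq92Concrete (mgauge)
open B8Ineq132 (BondTouches)
open B8Eq140Level (SideTouches sideTouches_mono Cond140)
open B8Eq143PlaqExpansion (pdiv)
open B8Eq146AExpansion (plaqCovDeriv)
open B8Eq184Proof (cfgExp)
open B8Thm2SetupTorus (cfgPull gaugePull pullDom)
open B10Eq27TorusAxialLog (pull unitsField toUField transl)
open B11Eq115Space (levOf)
open LatticeFieldCalculus (bondAvgIter laplace diverg siteAvgIter)
open FlatCubeOpsText (Adm22 IsLevWeight FlatOpsAdmAtMS)
open FlatCubeSequenceAligned (cubeSeqMT3)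
open FlatCubeSequenceAdm (adm22_cubeSeqMT3)
open FlatOpsLettersAssembly (flatH isFlatH_flatH)
open HalvingQuarterCubeSeq (inOm_top_of_dist)
open HalvingP1FlatPillar (DP1Clause P1FlatPillarAt P1FlatPillar)
open HalvingP1FlatPillarPrime (P1FlatPillarAt' P1FlatPillar' sideTouches_subset_cube0)
open HalvingStepOfPillars (layerChart_of_memberChart)
open HalvingAssemblyInterior (siteClause_of_pieces_int)
open FlatCubeSequenceAligned (cubeSetM)
open HalvingSitePackage (sitePackage_of_rows)
open Summit.QuantumFields.YangMills.Theorems.Prop8ChartDoubleBar (chartLogFlat)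

/-! ## §1 The last mile at one member -/

section Member

variable {F : T3Family} {n K : ℕ}

/-- **THE LAST MILE AT ONE MEMBER** (✓`Prop8LastMile.halvingMinimisers_of_localCharts167`'s body, member-local): for ONE configuration `U ∈ 𝔘_k(ε₀)` of one member,
(167)-charts around every site (asked only in the regime `B₃ε₁ < ε₀`, with (1.140)-radius `¼max{B₃ε₁, ½ε₀} + Kε₀²`) give `U ∈ 𝔘_k(max{B₃ε₁, ½ε₀})` whenever `ε₀ ≤ a₅`,
`a₅ ≤ 1∕90`, `24Ka₅ < 1`; the regime `ε₀ ≤ B₃ε₁` is the monotonicity of the spaces (2).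
[cite: Balaban1985Variational, (167)-(168) p.304, Prop. 8 p.304; Balaban1985RegularSpaces, (1.140) p.100] -/
theorem regPrHalving_of_memberCharts {B₃ Kc a₅ ε₀ ε₁ : ℝ} (hB₃ : 0 < B₃) (hK : 0 ≤ Kc) (ha₅ : a₅ ≤ 1 / 90) (hKa : 24 * Kc * a₅ < 1)
    (hε₁ : 0 < ε₁) (hε₀ : 0 < ε₀) (hε₀a : ε₀ ≤ a₅)
    (U : GaugeField (F.P K) 0 (Matrix.specialUnitaryGroup (Fin 2) ℂ)) (hUreg : RegPr F n K ε₀ U)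
    (H : B₃ * ε₁ < ε₀ → ∀ x : Site (F.P K) 0, ∃ (Ω : ℕ → Set (Site (F.P K) 0)) (u : GaugeTransf (F.P K) 0 (Matrix.unitaryGroup (Fin 2) ℂ))
        (A : GaugeField (F.P K) 0 (Matrix (Fin 2) (Fin 2) ℂ)),
        x ∈ Ω (K - n) ∧ (∀ b : PBond (F.P K) 0, IsSelfAdjoint (A b)) ∧
        (∀ j, j ≤ K - n → ∀ (z : B7Prop1Explicit.Site (F.P K).d) (μ : Fin (F.P K).d), SideTouches (pullDom Ω j) z μ →
          mgauge (cfgPull (F.P K) 1) (gaugePull (F.P K) u)⁻¹ (cfgPull (F.P K) (toUField U)) z μ =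
            cfgExp (((F.L : ℝ)⁻¹) ^ (K - n)) (pull A 0) z μ) ∧
        (∀ j, j ≤ K - n → Cond140 (F.P K).L (((F.L : ℝ)⁻¹) ^ (K - n)) (1 / 4 * max (B₃ * ε₁) (ε₀ / 2) + Kc * ε₀ ^ 2) j
          (pullDom Ω j) (cfgPull (F.P K) 1) (pull A 0))) :
    RegPr F n K (max (B₃ * ε₁) (ε₀ / 2)) U := by
  rcases le_or_gt ε₀ (B₃ * ε₁) with hcase | hcase
  · -- `ε₀ ≤ B₃ε₁`: monotonicity of the spaces (2)
    exact regPr_mono F (hcase.trans (le_max_left _ _)) hUreg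
  · -- the first case proper: `B₃ε₁ < ε₀ ≤ a₅`
    obtain ⟨hα₀, hα₀c, he₁, he₁c, hsum⟩ := Prop8LastMile.lastMile_arith hB₃ hK ha₅ hKa hε₁ hε₀ hε₀a hcase
    have h := Prop8LastMile.regPr_of_localCharts F n K hα₀ hα₀c he₁ he₁c U (H hcase)
    rwa [hsum] at h

end Member

/-! ## §2 The room halving in minimiser currency from the three displayed texts -/

section Door

/-- ★★ **THE ROOM HALVING, MINIMISER CURRENCY, FROM THE THREE DISPLAYED TEXTS** (LEAD-H L-4 ∕ ★★OWNER RULINGS №27 (R-a), №29 (A)): from the P2 text (hP2), the P1♭ v1.1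
text with the room letter `Nr` and premise `2ρ + Nr ≤ L^{F.m+n}` (hP1room — ✓`P1FlatPillar'` unfolded one level, no new predicate) and the C_E-end rows with their own floor
letter `Nce` and premise `Nce ≤ L^{F.m+n}` (hCE — otherwise byte-identical with ✓`halvingStep_of_rows'`'s), for every block size `L > 1`: a member floor `N`
(`:= max (2ρ + Nr) Nce` at the door's (163)-radius `ρ`), constants `B₃ > 4` (`= 4C′B₀B₃ᴾ²`) and `a₅ > 0`, such that every minimiser `U` of the Wilson action over
print's regular fibre (6)(ε₀) of a member with `N ≤ L^{F.m+n}`, `0 < ε₁`, `0 < ε₀ ≤ a₅`, lies in `𝔘_k(max{B₃ε₁, ½ε₀})`.  Even `L`: vacuous.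
[cite: Balaban1985Variational, (144) p.300, (152)-(168) pp.301-304, Prop. 8 p.304; Balaban1985RegularSpaces, Thm 2 p.83, (1.140) p.100] -/
theorem roomHalving_of_rows
    (hP2 : ∀ L : ℕ, Odd L → 1 < L → ∃ (R₀ M₀ : ℕ) (B₀ δ₀ B₃ : ℝ), 0 < B₀ ∧ 0 < δ₀ ∧ 0 < B₃ ∧ FlatOpsAdmAtMS L R₀ M₀ B₀ δ₀ B₃)
    (hP1room : ∀ L : ℕ, Odd L → 1 < L → ∃ (Mₚ Rₚ : ℕ), ∀ (R M aₑ S : ℕ) (hM : 1 ≤ M), M = L ^ aₑ → Mₚ ≤ M → Rₚ ≤ R → R * M ≤ S →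
      ∃ B₁ : ℝ, 0 ≤ B₁ ∧ ∃ Nr : ℕ,
      ∀ (ρ : ℕ) (a Cr : ℝ), 0 < Cr → 12 * ((ρ : ℝ) + (M : ℝ)) * a ≤ Cr →
        16 * 3800 * ((5 * L : ℕ) : ℝ) ^ 2 * (L : ℝ) * ((B₁ + 1) * a) ≤ 1 →
        ∀ F : T3Family, F.L = L → ∀ (n K : ℕ) (hnK : n < K), 2 * ρ + Nr ≤ F.L ^ (F.m + n) →
          ∀ (ε₀ ε₁ : ℝ), 0 < ε₁ → 0 < ε₀ → ε₀ ≤ a → Cr * ε₁ ≤ ε₀ →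
          ∀ V : GaugeField (F.P n) 0 (Matrix.specialUnitaryGroup (Fin 2) ℂ), PlaqSmall ε₁ V →
            ∀ U ∈ regFibrePr F n K hnK.le ε₀ V, ∀ x : Site (F.P K) 0,
              P1FlatPillarAt' F n K (cubeSeqMT3 F n K x ρ S M hM) (cubeSetM x (K - n) ρ S M 0) x ε₀ ε₁ B₁ 6 (8 * (L : ℝ) * (B₁ + 1)) U)
    (hCE : ∀ L : ℕ, Odd L → 1 < L → ∀ (R₀ M₀ : ℕ) (B₀ δ₀ B₃ : ℝ), 0 < B₀ → 0 < δ₀ → 0 < B₃ → FlatOpsAdmAtMS L R₀ M₀ B₀ δ₀ B₃ →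
      ∃ (M₁ R₁ : ℕ), ∀ (R M aₑ S : ℕ) (hM : 1 ≤ M), M = L ^ aₑ → M₁ ≤ M → M₀ ≤ M → R₁ ≤ R → R₀ ≤ R → R * M ≤ S →
      ∀ B₁ : ℝ, 0 ≤ B₁ →
      ∃ (Nce : ℕ) (K₁ K₂ C₂ Cce aCE : ℝ), 0 ≤ K₁ ∧ 0 ≤ K₂ ∧ 0 ≤ C₂ ∧ 0 ≤ Cce ∧ 0 < aCE ∧
      ∀ ρ : ℕ, 1 ≤ ρ → ∀ F : T3Family, F.L = L → ∀ (n K : ℕ) (hnK : n < K), Nce ≤ F.L ^ (F.m + n) →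
        ∀ (ε₀ ε₁ : ℝ), 0 < ε₁ → 0 < ε₀ → ε₀ ≤ aCE → Cce * ε₁ ≤ ε₀ →
        ∀ V : GaugeField (F.P n) 0 (Matrix.specialUnitaryGroup (Fin 2) ℂ), PlaqSmall ε₁ V →
          ∀ U ∈ regFibrePr F n K hnK.le ε₀ V,
            IsMinOn (fun W : GaugeField (F.P K) 0 (Matrix.specialUnitaryGroup (Fin 2) ℂ) => wilsonAction4 W) (regFibrePr F n K hnK.le ε₀ V) U →
            ∀ (x : Site (F.P K) 0) (C₂' : ℝ) (u : GaugeTransf (F.P K) 0 (Matrix.unitaryGroup (Fin 2) ℂ)) (A : PBond (F.P K) 0 → Matrix (Fin 2) (Fin 2) ℂ),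
              -- the seven conjuncts of `P1FlatPillarAt' F n K (cubeSeqMT3 …) (cubeSetM x (K−n) ρ S M 0) x ε₀ ε₁ B₁ 6 C₂' U` for THIS pair `(u, A)` ((ii′) on `□₀`)
              DP1Clause F n K (cubeSeqMT3 F n K x ρ S M hM) x U u →
              (∀ b : PBond (F.P K) 0, IsSelfAdjoint (A b)) → (∀ b : PBond (F.P K) 0, Matrix.trace (A b) = 0) →
              (∀ (z : B7Prop1Explicit.Site (F.P K).d) (μ : Fin (F.P K).d),
                transl (0 : Site (F.P K) 0) z ∈ cubeSetM x (K - n) ρ S M 0 → (transl (0 : Site (F.P K) 0) z).shift μ ∈ cubeSetM x (K - n) ρ S M 0 →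
                (Unitary.toUnits (u (transl 0 z)))⁻¹ * unitsField (toUField U) ⟨transl 0 z, μ⟩ * Unitary.toUnits (u ((transl 0 z).shift μ)) =
                  expUnit (I • ((((F.L : ℝ)⁻¹) ^ (K - n)) • A ⟨transl 0 z, μ⟩))) →
              (∀ w : ℕ → PBond (F.P K) 0 → ℝ, IsLevWeight F n K (cubeSeqMT3 F n K x ρ S M hM) w →
                (∀ b : PBond (F.P K) 0, w 1 b * ‖A b‖ ≤ B₁ * ε₀) ∧
                (∀ (b : PBond (F.P K) 0) (ν : Fin (F.P K).d), w 2 b * (F.L : ℝ) ^ (K - n) * ‖A ⟨b.src.shift ν, b.dir⟩ - A b‖ ≤ B₁ * ε₀)) →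
              (∃ μ : SiteIdx (cubeSeqMT3 F n K x ρ S M hM) → Matrix (Fin 2) (Fin 2) ℂ, ∀ s : Site (F.P K) 0,
                laplace ((F.L : ℝ) ^ (K - n)) (diverg ((F.L : ℝ) ^ (K - n)) A) s =
                  ∑ i : SiteIdx (cubeSeqMT3 F n K x ρ S M hM), siteAvgIter (i.1.1 : ℕ) (Pi.single s (1 : ℝ)) i.1.2 • μ i) →
              (∀ c : BondIdx (cubeSeqMT3 F n K x ρ S M hM), (c.1.1 : ℕ) = K - n →
                c.1.2.src ∈ (cubeSeqMT3 F n K x ρ S M hM).Om (c.1.1 : ℕ) → c.1.2.tgt ∈ (cubeSeqMT3 F n K x ρ S M hM).Om (c.1.1 : ℕ) →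
                ‖chartLogFlat (((F.L : ℝ)⁻¹) ^ (K - n)) (cubeSeqMT3 F n K x ρ S M hM) A c‖ ≤
                  6 * ε₁ * (distSite (Mk (F.P K) (c.1.1 : ℕ)) c.1.2.src (iterBlockOf (c.1.1 : ℕ) x) + 1)) →
              (∀ c : BondIdx (cubeSeqMT3 F n K x ρ S M hM), ‖chartLogFlat (((F.L : ℝ)⁻¹) ^ (K - n)) (cubeSeqMT3 F n K x ρ S M hM) A c‖ ≤ C₂' * ε₀) →
              -- OUTPUT: `sitePackage_of_rows`'s rows for some `Hs`, `C`, `e₁`, `e₃`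
              ∃ (Hs : (BondIdx (cubeSeqMT3 F n K x ρ S M hM) → Matrix (Fin 2) (Fin 2) ℂ) → (PBond (F.P K) 0 → Matrix (Fin 2) (Fin 2) ℂ))
                (C : (PBond (F.P K) 0 → Matrix (Fin 2) (Fin 2) ℂ) → (BondIdx (cubeSeqMT3 F n K x ρ S M hM) → Matrix (Fin 2) (Fin 2) ℂ))
                (e₁ e₃ : ℝ),
                ((∀ (z : B7Prop1Explicit.Site (F.P K).d) (τ : Fin (F.P K).d),
                    SideTouches (pullDom (fun j => if K - n ≤ j then ({x} : Set (Site (F.P K) 0)) else (∅ : Set (Site (F.P K) 0))) (K - n)) z τ →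
                    ‖((A + Hs (C A)) - fun b : PBond (F.P K) 0 => ∑ c, flatH F n K (cubeSeqMT3 F n K x ρ S M hM) (Pi.single c 1) b •
                        bondAvgIter (c.1.1 : ℕ) (A + Hs (C A)) c.1.2) ⟨transl 0 z, τ⟩‖ ≤ e₁) ∧
                  (∀ (z : B7Prop1Explicit.Site (F.P K).d) (κ τ : Fin (F.P K).d),
                    SideTouches (pullDom (fun j => if K - n ≤ j then ({x} : Set (Site (F.P K) 0)) else (∅ : Set (Site (F.P K) 0))) (K - n)) z τ →
                    ‖(((F.L : ℝ)⁻¹) ^ (K - n))⁻¹ •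
                      (((A + Hs (C A)) - fun b : PBond (F.P K) 0 => ∑ c, flatH F n K (cubeSeqMT3 F n K x ρ S M hM) (Pi.single c 1) b •
                          bondAvgIter (c.1.1 : ℕ) (A + Hs (C A)) c.1.2) ⟨(transl 0 z).shift κ, τ⟩ -
                        ((A + Hs (C A)) - fun b : PBond (F.P K) 0 => ∑ c, flatH F n K (cubeSeqMT3 F n K x ρ S M hM) (Pi.single c 1) b •
                          bondAvgIter (c.1.1 : ℕ) (A + Hs (C A)) c.1.2) ⟨transl 0 z, τ⟩)‖ ≤ e₁) ∧
                  (∀ (z : B7Prop1Explicit.Site (F.P K).d) (μ : Fin (F.P K).d),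
                    BondTouches (pullDom (fun j => if K - n ≤ j then ({x} : Set (Site (F.P K) 0)) else (∅ : Set (Site (F.P K) 0))) (K - n)) z μ →
                    ‖pdiv (((F.L : ℝ)⁻¹) ^ (K - n)) (1 : B7Prop1Explicit.Site (F.P K).d → Fin (F.P K).d → (Matrix (Fin 2) (Fin 2) ℂ)ˣ)
                        (plaqCovDeriv (((F.L : ℝ)⁻¹) ^ (K - n)) (1 : B7Prop1Explicit.Site (F.P K).d → Fin (F.P K).d → (Matrix (Fin 2) (Fin 2) ℂ)ˣ)
                          (pull ((A + Hs (C A)) - fun b : PBond (F.P K) 0 => ∑ c, flatH F n K (cubeSeqMT3 F n K x ρ S M hM) (Pi.single c 1) b •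
                            bondAvgIter (c.1.1 : ℕ) (A + Hs (C A)) c.1.2) 0)) μ z‖ ≤ e₁)) ∧
                ((∀ (z : B7Prop1Explicit.Site (F.P K).d) (τ : Fin (F.P K).d),
                    SideTouches (pullDom (fun j => if K - n ≤ j then ({x} : Set (Site (F.P K) 0)) else (∅ : Set (Site (F.P K) 0))) (K - n)) z τ →
                    ‖Hs (C A) ⟨transl 0 z, τ⟩‖ ≤ e₃) ∧
                  (∀ (z : B7Prop1Explicit.Site (F.P K).d) (κ τ : Fin (F.P K).d),
                    SideTouches (pullDom (fun j => if K - n ≤ j then ({x} : Set (Site (F.P K) 0)) else (∅ : Set (Site (F.P K) 0))) (K - n)) z τ →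
                    ‖(((F.L : ℝ)⁻¹) ^ (K - n))⁻¹ • (Hs (C A) ⟨(transl 0 z).shift κ, τ⟩ - Hs (C A) ⟨transl 0 z, τ⟩)‖ ≤ e₃) ∧
                  (∀ (z : B7Prop1Explicit.Site (F.P K).d) (μ : Fin (F.P K).d),
                    BondTouches (pullDom (fun j => if K - n ≤ j then ({x} : Set (Site (F.P K) 0)) else (∅ : Set (Site (F.P K) 0))) (K - n)) z μ →
                    ‖pdiv (((F.L : ℝ)⁻¹) ^ (K - n)) (1 : B7Prop1Explicit.Site (F.P K).d → Fin (F.P K).d → (Matrix (Fin 2) (Fin 2) ℂ)ˣ)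
                        (plaqCovDeriv (((F.L : ℝ)⁻¹) ^ (K - n)) (1 : B7Prop1Explicit.Site (F.P K).d → Fin (F.P K).d → (Matrix (Fin 2) (Fin 2) ℂ)ˣ)
                          (pull (Hs (C A)) 0)) μ z‖ ≤ e₃)) ∧
                (∀ c : BondIdx (cubeSeqMT3 F n K x ρ S M hM), (c.1.1 : ℕ) = K - n →
                  c.1.2.src ∈ (cubeSeqMT3 F n K x ρ S M hM).Om (c.1.1 : ℕ) → c.1.2.tgt ∈ (cubeSeqMT3 F n K x ρ S M hM).Om (c.1.1 : ℕ) →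
                  ‖bondAvgIter (c.1.1 : ℕ) (A + Hs (C A)) c.1.2‖ ≤ 6 * ε₁ * (distSite (Mk (F.P K) (c.1.1 : ℕ)) c.1.2.src (iterBlockOf (c.1.1 : ℕ) x) + 1)) ∧
                (∀ c : BondIdx (cubeSeqMT3 F n K x ρ S M hM),
                  ¬ ((c.1.1 : ℕ) = K - n ∧ c.1.2.src ∈ (cubeSeqMT3 F n K x ρ S M hM).Om (c.1.1 : ℕ) ∧
                      c.1.2.tgt ∈ (cubeSeqMT3 F n K x ρ S M hM).Om (c.1.1 : ℕ)) →
                  ‖bondAvgIter (c.1.1 : ℕ) (A + Hs (C A)) c.1.2‖ ≤ C₂ * ε₀ * (F.L : ℝ) ^ ((K - n) - (c.1.1 : ℕ))) ∧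
                e₁ ≤ K₁ * ε₀ ^ 2 ∧ e₃ ≤ K₂ * ε₀ ^ 2) :
    ∀ L : ℕ, 1 < L → ∃ (N : ℕ) (B₃ a₅ : ℝ), 4 < B₃ ∧ 0 < a₅ ∧
      ∀ F : T3Family, F.L = L → ∀ (n K : ℕ) (hnK : n < K), N ≤ F.L ^ (F.m + n) →
        ∀ (ε₀ ε₁ : ℝ), 0 < ε₁ → 0 < ε₀ → ε₀ ≤ a₅ →
          ∀ V : GaugeField (F.P n) 0 (Matrix.specialUnitaryGroup (Fin 2) ℂ), PlaqSmall ε₁ V →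
            ∀ U ∈ regFibrePr F n K hnK.le ε₀ V,
              IsMinOn (fun W : GaugeField (F.P K) 0 (Matrix.specialUnitaryGroup (Fin 2) ℂ) => wilsonAction4 W) (regFibrePr F n K hnK.le ε₀ V) U →
                RegPr F n K (max (B₃ * ε₁) (ε₀ / 2)) U := by
  intro L hL
  by_cases hodd : Odd L
  swap
  · -- even `L`: no member, the minimiser form is vacuous
    exact ⟨0, 5, 1, by norm_num, one_pos, fun F hF => absurd (hF ▸ F.hL.1) hodd⟩
  -- the P2 text and its constants
  obtain ⟨R₀, M₀, B₀, δ₀, B₃, hB₀, hδ₀, hB₃, hP2L⟩ := hP2 L hodd hL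
  -- the C_E thresholds
  obtain ⟨M₁, R₁, hCE₁⟩ := hCE L hodd hL R₀ M₀ B₀ δ₀ B₃ hB₀ hδ₀ hB₃ hP2L
  -- the P1♭ supplier's floors
  obtain ⟨Mₚ, Rₚ, hP1₁⟩ := hP1room L hodd hL
  -- the geometry of the cube sequence: `M = L^{aₑ} ≥ max (max M₁ M₀) Mₚ`, `R = max (max R₁ R₀) (max 1 Rₚ)`, `S = R·M`
  set aₑ : ℕ := max (max M₁ M₀) Mₚ with haₑ
  set M : ℕ := L ^ aₑ with hMdef
  have hL2 : 2 ≤ L := hL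
  have hpow : aₑ ≤ L ^ aₑ := (Nat.lt_pow_self (by omega)).le
  have hM₁M : M₁ ≤ M := ((le_max_left _ _).trans (le_max_left _ _)).trans hpow
  have hM₀M : M₀ ≤ M := ((le_max_right _ _).trans (le_max_left _ _)).trans hpow
  have hMₚM : Mₚ ≤ M := (le_max_right _ _).trans hpow
  have hM1 : 1 ≤ M := Nat.one_le_pow _ _ (by omega)
  set R : ℕ := max (max R₁ R₀) (max 1 Rₚ) with hRdef
  have hR1 : 1 ≤ R := (le_max_left _ _).trans (le_max_right _ _)
  have hRₚR : Rₚ ≤ R := (le_max_right _ _).trans (le_max_right _ _)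
  set S : ℕ := R * M with hSdef
  -- P1♭'s size constant and room letter (ρ-free)
  obtain ⟨B₁, hB₁, Nr, hP1L⟩ := hP1₁ R M aₑ S hM1 rfl hMₚM hRₚR le_rfl
  -- the C_E floor letter and constants (ρ-free)
  obtain ⟨Nce, K₁, K₂, C₂, Cce, aCE, hK₁, hK₂, hC₂, hCce, haCE, hCE₂⟩ :=
    hCE₁ R M aₑ S hM1 rfl hM₁M hM₀M ((le_max_left _ _).trans (le_max_left _ _)) ((le_max_right _ _).trans (le_max_left _ _)) le_rfl B₁ hB₁
  -- the package constant `C′` and the inner radius `ρ` by (163)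
  have hBB : 0 < B₀ * B₃ := mul_pos hB₀ hB₃
  set C' : ℝ := max (max 12 C₂) ((Cce + 2) / (B₀ * B₃)) with hC'def
  have hC'12 : (12 : ℝ) ≤ C' := (le_max_left _ _).trans (le_max_left _ _)
  have hC'C₂ : C₂ ≤ C' := (le_max_right _ _).trans (le_max_left _ _)
  have hC'ce : (Cce + 2) / (B₀ * B₃) ≤ C' := le_max_right _ _
  have hC'0 : 0 ≤ C' := by linarith
  have hCBB : Cce + 2 ≤ C' * (B₀ * B₃) := by
    have := (div_le_iff₀ hBB).1 hC'ce
    linarith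
  have hT0 : 0 ≤ 4 * C' * B₀ * B₃ := by positivity
  obtain ⟨ρ, hρ2, h163⟩ := HalvingAssembly.exists_rho_163 hδ₀ hT0
  have hρ1 : 1 ≤ ρ := by
    have : (1 : ℝ) ≤ (ρ : ℝ) := by linarith
    exact_mod_cast this
  -- the ratio `Cr = 4C′B₀B₃` and the ceiling `a` (after `ρ`)
  set Cr : ℝ := 4 * C' * B₀ * B₃ with hCrdef
  have hCBB2 : (2 : ℝ) ≤ C' * (B₀ * B₃) := by linarith
  have hCr4ring : (4 : ℝ) * C' * B₀ * B₃ = 4 * (C' * (B₀ * B₃)) := by ring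
  have hCr8 : (8 : ℝ) ≤ Cr := by rw [hCrdef, hCr4ring]; linarith
  have hCceCr : Cce ≤ Cr := by rw [hCrdef, hCr4ring]; linarith
  have hCr : 0 < Cr := by linarith
  have hρM : 0 < 12 * ((ρ : ℝ) + (M : ℝ)) := by positivity
  have hden : 0 < 16 * 3800 * ((5 * L : ℕ) : ℝ) ^ 2 * (L : ℝ) * (B₁ + 1) := by
    have : (0 : ℝ) < L := by exact_mod_cast (by omega : 0 < L)
    have : (0 : ℝ) < ((5 * L : ℕ) : ℝ) := by positivity
    positivity
  set a : ℝ := min aCE (min (Cr / (12 * ((ρ : ℝ) + (M : ℝ)))) (1 / (16 * 3800 * ((5 * L : ℕ) : ℝ) ^ 2 * (L : ℝ) * (B₁ + 1))))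
    with hadef
  have ha : 0 < a := lt_min haCE (lt_min (div_pos hCr hρM) (div_pos one_pos hden))
  have haCE' : a ≤ aCE := min_le_left _ _
  have hreg₁ : 12 * ((ρ : ℝ) + (M : ℝ)) * a ≤ Cr := by
    have h1 : a ≤ Cr / (12 * ((ρ : ℝ) + (M : ℝ))) := (min_le_right _ _).trans (min_le_left _ _)
    have := (le_div_iff₀ hρM).1 h1
    linarith
  have hreg₀ : 16 * 3800 * ((5 * L : ℕ) : ℝ) ^ 2 * (L : ℝ) * ((B₁ + 1) * a) ≤ 1 := by
    have h1 : a ≤ 1 / (16 * 3800 * ((5 * L : ℕ) : ℝ) ^ 2 * (L : ℝ) * (B₁ + 1)) := (min_le_right _ _).trans (min_le_right _ _)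
    have := (le_div_iff₀ hden).1 h1
    linarith
  -- P1♭ at these constants, at the members with room
  have hP1' := hP1L ρ a Cr hCr hreg₁ hreg₀
  -- the stub's constants: `B₃ := Cr`, `a₅ := exists_a5 (K₁ + K₂ + 1) a`, floor `N := max (2ρ + Nr) Nce`
  have hKc : (0 : ℝ) ≤ K₁ + K₂ + 1 := by positivity
  obtain ⟨a₅, ha₅, ha₅a, ha₅90, hKa⟩ := Prop8LastMile.exists_a5 hKc ha
  have hCr4 : 4 < Cr := by linarith
  refine ⟨max (2 * ρ + Nr) Nce, Cr, a₅, hCr4, ha₅, ?_⟩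
  have hR₀R : R₀ ≤ R := (le_max_right R₁ R₀).trans (le_max_left _ _)
  have hS1 : 1 ≤ S := by
    show 1 ≤ R * M
    exact Nat.one_le_iff_ne_zero.mpr (Nat.mul_ne_zero (by omega) (by omega))
  have hRS : R * M ≤ S := le_rfl
  intro F hF n K hnK hN ε₀ ε₁ hε₁ hε₀ hε₀a₅ V hV U hU hmin
  have hNr : 2 * ρ + Nr ≤ F.L ^ (F.m + n) := (le_max_left _ _).trans hN
  have hNce : Nce ≤ F.L ^ (F.m + n) := (le_max_right _ _).trans hN
  have hUreg : RegPr F n K ε₀ U := ((mem_regFibrePr_iff F).mp hU).2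
  have hε₀a : ε₀ ≤ a := hε₀a₅.trans ha₅a
  -- P1♭ → (u, A) → hCE → the package → P2 at the cube sequence → the (167)-chart at every site → §1
  refine regPrHalving_of_memberCharts (Kc := K₁ + K₂ + 1) hCr hKc ha₅90 hKa hε₁ hε₀ hε₀a₅ U hUreg fun hreg x => ?_
  -- P1♭ at the member and the site
  obtain ⟨u, A, ho, hsa, htr, hii, hiii, hiv, hvi, hvii⟩ := hP1' F hF n K hnK hNr ε₀ ε₁ hε₁ hε₀ hε₀a hreg.le V hV U hU x
  have hii_mem : ∀ j, 1 ≤ j → j ≤ K - n → ∀ (z : B7Prop1Explicit.Site (F.P K).d) (μ : Fin (F.P K).d),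
      SideTouches (pullDom (fun i => {y : Site (F.P K) 0 | (cubeSeqMT3 F n K x ρ S M hM1).InOm i y}) j) z μ →
      (Unitary.toUnits (u (transl 0 z)))⁻¹ * unitsField (toUField U) ⟨transl 0 z, μ⟩ * Unitary.toUnits (u ((transl 0 z).shift μ)) =
        expUnit (I • ((((F.L : ℝ)⁻¹) ^ (K - n)) • A ⟨transl 0 z, μ⟩)) :=
    fun j h1 hjk z μ hz => hii z μ (sideTouches_subset_cube0 x ρ S M hM1 hS1 j h1 hjk z μ hz).1
      (sideTouches_subset_cube0 x ρ S M hM1 hS1 j h1 hjk z μ hz).2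
  -- the C_E rows
  have hCceε : Cce * ε₁ ≤ ε₀ := (mul_le_mul_of_nonneg_right hCceCr hε₁.le).trans hreg.le
  obtain ⟨Hs, C, e₁, e₃, h165, h157, hnear, hfar, he₁, he₃⟩ :=
    hCE₂ ρ hρ1 F hF n K hnK hNce ε₀ ε₁ hε₁ hε₀ (hε₀a.trans haCE') hCceε V hV U hU hmin x _ u A ho hsa htr hii hiii hiv hvi hvii
  -- the package at the site
  obtain ⟨u', A', A₁, Rm, B, hA, hchart, hdec, hnear', hfar', s₁, g₁, d₁, s₃, g₃, d₃⟩ :=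
    sitePackage_of_rows x ρ S M hM1 U u A Hs C hsa (layerChart_of_memberChart hnK x ρ S M hM1 hii_mem) h165 h157 hnear hfar he₁ he₃
  -- P2 at the cube sequence centred at `x`, with the canonical level weights
  have hAdm : Adm22 (cubeSeqMT3 F n K x ρ S M hM1) R M := adm22_cubeSeqMT3 F n K x ρ hM1 hRS
  have hw : IsLevWeight F n K (cubeSeqMT3 F n K x ρ S M hM1)
      (fun m b => ((F.L : ℝ) ^ levOf (fun j => {y : Site (F.P K) 0 | (cubeSeqMT3 F n K x ρ S M hM1).InOm j y}) (K - n) b.src *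
        ((F.L : ℝ)⁻¹) ^ (K - n)) ^ m) := fun _ _ => rfl
  obtain ⟨H, Gt, hFH, -, -, -, -, dBI, hdom, h162, hHd⟩ :=
    hP2L F hF n K hnK R M hR₀R hM₀M ⟨aₑ, hMdef⟩ (cubeSeqMT3 F n K x ρ S M hM1) rfl hAdm _ hw
  -- the text's `H` IS the canonical `flatH`
  have hHeq : H = flatH F n K (cubeSeqMT3 F n K x ρ S M hM1) :=
    LinearMap.ext fun X => funext fun b =>
      (hFH X b).trans (isFlatH_flatH (F := F) (n := n) (K := K) (D := cubeSeqMT3 F n K x ρ S M hM1) X b).symm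
  rw [hHeq] at hHd
  -- the per-site clause of the (167)-chart schema
  have hε₀2 : 0 < ε₀ ^ 2 := by positivity
  have hρR : (0 : ℝ) ≤ (ρ : ℝ) - 2 := by linarith
  have h163' : 4 * C' * B₀ * B₃ * Real.exp (-(δ₀ / 2 * ((ρ : ℝ) - 2))) ≤ 1 / 2 := h163
  have hα₂ : K₁ * ε₀ ^ 2 + 1 / 4 * max (4 * C' * B₀ * B₃ * ε₁) (ε₀ / 2) + K₂ * ε₀ ^ 2 <
      1 / 4 * max (Cr * ε₁) (ε₀ / 2) + (K₁ + K₂ + 1) * ε₀ ^ 2 := by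
    rw [hCrdef]; linarith
  exact siteClause_of_pieces_int hnK x ρ S M hM1 hw hdom hHd h162 hδ₀.le hB₀.le hB₃.le (C₁ := 6) (C := C') (by norm_num) (by linarith) hC'C₂
    hε₁.le hε₀.le hρR h163' le_rfl hα₂ U u' hA hchart (fun _ => rfl) hdec hnear' hfar' s₁ g₁ d₁ s₃ g₃ d₃

end Door

end Summit.QuantumFields.YangMills.Theorems.HalvingStepOfPillarsRoom

end
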